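import Summits.BirchSwinnertonDyer.BirchSwinnertonDyer.Theorems.GenusKolyvaginAtTwoMinimalTwinBSDTwoIdentityDoor
import Summits.BirchSwinnertonDyer.BirchSwinnertonDyer.Theorems.GenusKolyvaginAtTwoMinimalTwinBSDTwoTranspositionDoor
import Summits.BirchSwinnertonDyer.BirchSwinnertonDyer.Theorems.GenusKolyvaginAtTwoGenusPrimitiveSupplyAtTwoTwistMasterFrame
import Summits.BirchSwinnertonDyer.BirchSwinnertonDyer.Theorems.GenusKolyvaginAtTwoKramerParityOfFrame
import Summits.BirchSwinnertonDyer.BirchSwinnertonDyer.Theorems.GenusKolyvaginAtTwoGenusPrimitiveSupplyAtTwoArchimedeanKummerCard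
import Summits.BirchSwinnertonDyer.BirchSwinnertonDyer.Theorems.GenusKolyvaginAtTwoGenusPrimitiveSupplyAtTwoArchimedeanCapstone
import Summits.BirchSwinnertonDyer.BirchSwinnertonDyer.Theorems.GenusKolyvaginAtTwoGenusPrimitiveSupplyAtTwoTwistMultiFrame
import HarnessLib

/-!
# Route `GenusKolyvaginAtTwo`, crux U₂ `MinimalTwinBSDTwo` (stmt-BirchSwinnertonDyer-22985) and the residual item `OffCutResidualAtTwoR` (stmt-31767, LINE 24
# «strict_def2» stub A⁼²): THE IDENTITY-PRIME DOOR ON THE STRICT CELL — for a rank-ZERO curve with `#Sel₂(E) = 4`, every class trivial at `∞`, an identity prime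
# `ℓ` at which `Sel₂(E)` restricts to a basis of `E(ℚ_ℓ)/2` gives a `2`-Selmer-MINIMAL twin: `#Sel₂(E^{(−ℓ)}) = 2` (UNCONDITIONAL)

Seat `bsd-line-gk2-p2` g26 (PROVER seat 2/3, cell `bsd-f1-sign2`, LINE 23 holder), `--supports stmt-BirchSwinnertonDyer-22985` (helper; closes nothing).
THEOREMS ONLY (no definition, no named fact, no `sorry`); standard axioms; UNCONDITIONAL.  **BSD is NOT proved by this file; nothing is closed.**

WHY.  Part 1 (`natCard_selmerGroup_mul_natCard_dvd_of_transverse_of_injective_relaxed`) assumed the localisation at `v₀` injective on the whole `w`-RELAXED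
Selmer group (the U₂ identity locus: `#Sel^{rel ∞} = 4`).  On the STRICT cell of the residual item 31767 (rank `0`, `Sel₂(E) = Ш(E)[2]` of order `4`, all classes
trivial at `∞`; LINE 24 «strict_def2», `Cruxes/OffCutResidualAtTwoR/Lines/strict_def2.lean`, stub A⁼² «Lagrangian count at `T = {∞, q}`, untried») the relaxed group
has order `8` and cannot inject into `H¹_f(ℚ_q)`; the right hypothesis is injectivity on the `w`-STRICT group only.  This file proves that variant and its
`ℚ`-instance: the twin then has `#Sel₂ = 2` — a `2`-Selmer-minimal rank-one candidate of Tamagawa defect `2`, as A⁼² wants.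

* §1 **`natCard_selmerGroup_mul_natCard_dvd_of_transverse_of_injective_strict`** — congruent pair `φ : Y[p] ⥲ E[p]`, `𝓐 = φ_* 𝓚_Y` agreeing with `𝓚_E` off `{w, v₀}`,
  transverse at `v₀`, `loc_{v₀}` injective on `H¹_{𝓚_{w}}(E)`: **`#Sel^{(p)}(Y) · #H¹_{𝓚_{w}}(E) ∣ #𝓛_w · t_{v₀}`**.  (`H¹_𝓐 ∩ H¹_{𝓚^w}` lies in the classes of
  `H¹_{𝓚^w}` dying at `v₀`, a group meeting `H¹_{𝓚_w}` trivially, hence of order `∣ [H¹_{𝓚^w} : H¹_{𝓚_w}] = #𝓛_w`.)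
* §2 **`natCard_selmerGroup_twin_eq_two_of_identityDoor_strict`** — over `ℚ`: `W` globally minimal, `Δ > 0`, `#Sel₂(W) = 4` with every class trivial at `∞`,
  `K = ℚ(√−ℓ)` Heegner, `2` split, `ℓ` an identity prime (`#W(ℚ_ℓ)[2] = 4`) with `Sel₂(W) ∩ strictLocalKer_ℓ = 0`: **`#Sel₂(W^{(d_K)}) = 2`** (`∣ 2` by §1 with
  `#𝓛_∞ = 2`, `t_ℓ = 4`; `= 2` by Kramer's framed congruence, `#Sel₂(Wd) · 4 · 8` a square).

References: [MazurRubin2010] Def. 3.1, Lemma 3.2, Prop. 3.3, Lemmas 2.9–2.11; [Kramer1981] Prop. 6, Thm. 1; [MilneADT2006] I Thm. 2.13, 4.10.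
-/

set_option linter.dupNamespace false -- tree convention: `Summit.BirchSwinnertonDyer.BirchSwinnertonDyer.Theorems` (summit = sub-problem)
set_option autoImplicit false

noncomputable section

open scoped Classical ContRepresentation

open CategoryTheory Field Function NumberField IsDedekindDomain WeierstrassCurve
open Literature.NumberTheory.EllipticCurves
open Literature.NumberTheory.GaloisRepresentations
open Literature.NumberTheory.GaloisRepresentations.DiscreteGaloisModule (SelmerStructure)
open Literature.NumberTheory.GaloisRepresentations.IsNonarchimedeanLocalField (maxUnramified)
open Literature.NumberTheory.GaloisCohomology
open Summit.BirchSwinnertonDyer.Rank1Residual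
open Summit.BirchSwinnertonDyer.Rank1Residual.X11b.KummerPT (kummerRelaxed kummerStrict kummerRelaxed_of_mem kummerRelaxed_of_not_mem
  kummerStrict_of_mem kummerStrict_of_not_mem)
open Summit.BirchSwinnertonDyer.Rank1Residual.X11b.CongruentTransfer
open Summit.BirchSwinnertonDyer.Rank1Residual.GaloisImage.CoreRankZero (selmerGroup_mono)
open Summit.BirchSwinnertonDyer.Rank1Residual.X11b.SelmerCount (card_mul_relIndex_of_le)
open Summit.BirchSwinnertonDyer.BirchSwinnertonDyer.Theorems.GenusKolyArch

namespace Summit.BirchSwinnertonDyer.BirchSwinnertonDyer.Theorems.GenusExact.TwinSwap.IdentityDoor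

/-! ## §1 The abstract identity-door law with injectivity on the STRICT group only -/

section StrictLaw

variable {K : Type} [Field K] [NumberField K] (W Y : WeierstrassCurve K) [W.IsElliptic] (p : ℕ) [hp : Fact p.Prime]

/-- **THE ABSTRACT IDENTITY-DOOR LAW, STRICT FORM.**  Congruent pair `φ : Y[p] ⥲ E[p]` (inverse `ψ`) over a number field `K`, transported structure
`𝓐 = φ_* 𝓚_Y`, a real place `w`, a finite place `v₀`; `𝓐` agrees with `𝓚_E` off `{w, v₀}`, is TRANSVERSE to `𝓚_E` at `v₀`, and `loc_{v₀}` is INJECTIVE on the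
`w`-STRICT Selmer group `H¹_{𝓚_{w}}(E)`.  THEN **`#Sel^{(p)}(Y) · #H¹_{𝓚_{w}}(E) ∣ #𝓛_w · (#E(K_{v₀})[p] · #(𝓞_{v₀}/p))`**.  Proof: `H¹_{𝓚_{w,v₀}} = 0`; part 1's
mixed count gives `#H¹_{𝓚^{w,v₀}} = #𝓛_w · t`, and `#H¹_{𝓚^{w}} = #𝓛_w · #H¹_{𝓚_{w}}`; `H¹_𝓐 ∩ H¹_{𝓚^w}` lies in `R₀ = H¹(𝓚: ⊤ at w, ⊥ at v₀)` (transversality), which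
meets `H¹_{𝓚_w}` in `H¹_{𝓚_{w,v₀}} = 0`, so `#(H¹_𝓐 ∩ H¹_{𝓚^w}) ∣ #R₀ ∣ #𝓛_w`; and `#H¹_𝓐 / #(H¹_𝓐 ∩ H¹_{𝓚^w}) = [H¹_𝓐 ⊔ H¹_{𝓚^w} : H¹_{𝓚^w}] ∣
[H¹_{𝓚^{w,v₀}} : H¹_{𝓚^w}] = t / #H¹_{𝓚_w}`.  CONDITIONAL only on the displayed print facts `hPT`, `hEP`.
[cite: MazurRubin2010, Def. 3.1, Lemma 3.2, Prop. 3.3 (method)] [cite: Howard2004HeegnerKolyvagin, Thm. 2.1.11 (arXiv:1202.6340 p. 6)] -/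
theorem natCard_selmerGroup_mul_natCard_dvd_of_transverse_of_injective_strict
    (hPT : poitouTate_selmerStructure_duality_real K)
    (hEP : ∀ v : HeightOneSpectrum (𝓞 K), localEulerPoincareCharacteristic (v.adicCompletion K))
    (φ : (Y.torsionGaloisModule (p : ℤ)).toContRepresentation →ⁱL
      (W.torsionGaloisModule (p : ℤ)).toContRepresentation)
    (ψ : (W.torsionGaloisModule (p : ℤ)).toContRepresentation →ⁱL
      (Y.torsionGaloisModule (p : ℤ)).toContRepresentation)
    (hψφ : ∀ a, ψ (φ a) = a) (hφψ : ∀ b, φ (ψ b) = b)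
    (𝓐 : SelmerStructure (W.torsionGaloisModule (p : ℤ)))
    (h𝓐 : ∀ v, 𝓐 v = (Y.kummerSelmerStructure (p : ℤ) v).map
      (galoisCohomology.map (φ.restrictField (Place.Completion v)) 1))
    {w : InfinitePlace K} (hw : w.IsReal) (v₀ : HeightOneSpectrum (𝓞 K))
    (hagree : ∀ v : Place K, v ≠ Sum.inl w → v ≠ Sum.inr v₀ → 𝓐 v = W.kummerSelmerStructure (p : ℤ) v)
    (htr : 𝓐 (Sum.inr v₀) ⊓ W.kummerSelmerStructure (p : ℤ) (Sum.inr v₀) = ⊥)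
    (hinj : ∀ c ∈ (kummerStrict W p {(Sum.inl w : Place K)}).selmerGroup,
      galoisCohomology.localization (W.torsionGaloisModule (p : ℤ)) (Sum.inr v₀) 1 c = 0 → c = 0) :
    Nat.card (Y.selmerGroup (p : ℤ)) * Nat.card (kummerStrict W p {(Sum.inl w : Place K)}).selmerGroup ∣
      Nat.card (W.kummerSelmerStructure (p : ℤ) (Sum.inl w)) *
        (Nat.card (nsmulAddMonoidHom p : (W.baseChange (v₀.adicCompletion K)).toAffine.Point →+ _).ker *
          Nat.card (v₀.adicCompletionIntegers K ⧸ Ideal.span {(p : v₀.adicCompletionIntegers K)})) := by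
  haveI : NeZero p := ⟨hp.out.ne_zero⟩
  have h12 : (Sum.inl w : Place K) ≠ Sum.inr v₀ := Sum.inl_ne_inr
  set S : Finset (Place K) := {(Sum.inl w : Place K), Sum.inr v₀} with hSdef
  have hwS : (Sum.inl w : Place K) ∈ S := by simp [hSdef]
  have hv₀S : (Sum.inr v₀ : Place K) ∈ S := by simp [hSdef]
  set R := (kummerRelaxed W p {(Sum.inl w : Place K)}).selmerGroup with hRdef
  set Str := (kummerStrict W p {(Sum.inl w : Place K)}).selmerGroup with hStrdef
  set D := (kummerRelaxed W p S).selmerGroup with hDdef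
  set A := (kummerStrict W p S).selmerGroup with hAdef
  set B := 𝓐.selmerGroup with hBdef
  -- the classes of `R` dying at `v₀`: the structure `⊤` at `w`, `⊥` at `v₀`, Kummer elsewhere
  set P₀ : SelmerStructure (W.torsionGaloisModule (p : ℤ)) :=
    Function.update (kummerRelaxed W p {(Sum.inl w : Place K)}) (Sum.inr v₀) ⊥ with hP₀def
  set R₀ := P₀.selmerGroup with hR₀def
  set t := Nat.card (nsmulAddMonoidHom p : (W.baseChange (v₀.adicCompletion K)).toAffine.Point →+ _).ker *
    Nat.card (v₀.adicCompletionIntegers K ⧸ Ideal.span {(p : v₀.adicCompletionIntegers K)}) with htdef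
  set ℓw := Nat.card (W.kummerSelmerStructure (p : ℤ) (Sum.inl w)) with hℓwdef
  -- orders
  have hAStr : A ≤ Str := selmerGroup_mono (fun v ↦ by
    by_cases hv : v ∈ S
    · rw [kummerStrict_of_mem W p S hv]; exact bot_le
    · have hne : v ∉ ({(Sum.inl w : Place K)} : Finset (Place K)) := fun h ↦ hv (by rw [Finset.mem_singleton.mp h]; exact hwS)
      rw [kummerStrict_of_not_mem W p S hv, kummerStrict_of_not_mem W p _ hne])
  have hRD : R ≤ D := selmerGroup_mono (kummerRelaxed_singleton_le_kummerRelaxed_of_mem W p S hwS)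
  have hStrR : Str ≤ R := selmerGroup_mono (X11b.KummerPT.kummerStrict_le_kummerRelaxed W p _)
  have hR₀R : R₀ ≤ R := selmerGroup_mono (fun v ↦ by
    by_cases hv : v = Sum.inr v₀
    · subst hv; rw [hP₀def, Function.update_self]; exact bot_le
    · rw [hP₀def, Function.update_of_ne hv])
  have hagreeS : ∀ v ∉ S, 𝓐 v = W.kummerSelmerStructure (p : ℤ) v := fun v hv ↦
    hagree v (fun h ↦ hv (h ▸ hwS)) (fun h ↦ hv (h ▸ hv₀S))
  have hBD : B ≤ D := (selmerGroup_sandwich_of_agree W p S hagreeS).2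
  -- `A = ⊥`
  have hA : A = ⊥ := by
    rw [eq_bot_iff]
    intro c hc
    rw [AddSubgroup.mem_bot]
    refine hinj c (hAStr hc) ?_
    have h := (SelmerStructure.mem_selmerGroup_iff _ _).mp hc (Sum.inr v₀)
    rwa [kummerStrict_of_mem W p S hv₀S, AddSubgroup.mem_bot] at h
  -- `R₀ ⊓ Str = ⊥`
  have hR₀Str : Str ⊓ R₀ = ⊥ := by
    rw [eq_bot_iff]
    intro c hc
    rw [AddSubgroup.mem_bot]
    obtain ⟨hcS, hcR₀⟩ := AddSubgroup.mem_inf.mp hc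
    refine hinj c hcS ?_
    have h := (SelmerStructure.mem_selmerGroup_iff _ _).mp hcR₀ (Sum.inr v₀)
    rwa [hP₀def, Function.update_self, AddSubgroup.mem_bot] at h
  -- counts
  have hcardD : Nat.card D = ℓw * t := by
    have h := relIndex_kummerStrict_kummerRelaxed_inl_inr_eq_of_facts W p hPT hEP hw v₀
    rw [← hAdef, ← hDdef, hA, AddSubgroup.relIndex_bot_left] at h
    exact h
  have hidxR : Str.relIndex R = ℓw := by
    have h := relIndex_kummerStrict_kummerRelaxed_singleton_inl_eq_of_facts W p hp.out.isPrimePow hPT hEP w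
    rw [← hStrdef, ← hRdef] at h
    exact h
  have hcardR : Nat.card Str * ℓw = Nat.card R := by
    rw [← hidxR]; exact card_mul_relIndex_of_le hStrR
  -- `#R₀ ∣ #𝓛_w`
  have hR₀dvd : Nat.card R₀ ∣ ℓw := by
    have h1 : Str.relIndex (Str ⊔ R₀) = Nat.card R₀ := by
      rw [AddSubgroup.relIndex_sup_left, ← AddSubgroup.inf_relIndex_right, hR₀Str, AddSubgroup.relIndex_bot_left]
    have hchain := AddSubgroup.relIndex_mul_relIndex Str (Str ⊔ R₀) R le_sup_left (sup_le hStrR hR₀R)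
    rw [h1, hidxR] at hchain
    exact Dvd.intro _ hchain
  -- `B ⊓ R ≤ R₀`
  have hBR : R ⊓ B ≤ R₀ := by
    intro c hc
    obtain ⟨hcR, hcB⟩ := AddSubgroup.mem_inf.mp hc
    rw [hR₀def, SelmerStructure.mem_selmerGroup_iff]
    intro v
    by_cases hv : v = Sum.inr v₀
    · subst hv
      rw [hP₀def, Function.update_self, AddSubgroup.mem_bot]
      have h1 := (SelmerStructure.mem_selmerGroup_iff _ _).mp hcB (Sum.inr v₀)
      have h2 := (SelmerStructure.mem_selmerGroup_iff _ _).mp hcR (Sum.inr v₀)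
      have hne : (Sum.inr v₀ : Place K) ∉ ({(Sum.inl w : Place K)} : Finset (Place K)) := by simp
      rw [kummerRelaxed_of_not_mem W p _ hne] at h2
      have h3 : galoisCohomology.localization (W.torsionGaloisModule (p : ℤ)) (Sum.inr v₀) 1 c ∈
          𝓐 (Sum.inr v₀) ⊓ W.kummerSelmerStructure (p : ℤ) (Sum.inr v₀) := AddSubgroup.mem_inf.mpr ⟨h1, h2⟩
      rwa [htr, AddSubgroup.mem_bot] at h3
    · rw [hP₀def, Function.update_of_ne hv]
      exact (SelmerStructure.mem_selmerGroup_iff _ _).mp hcR v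
  -- `#B = #(R ⊓ B) · [R ⊔ B : R]` and `[R ⊔ B : R] ∣ [D : R]`
  set RB : AddSubgroup (galoisCohomology (W.torsionGaloisModule (p : ℤ)) 1) := R ⊓ B with hRBdef
  have hBeq : Nat.card RB * R.relIndex (R ⊔ B) = Nat.card B := by
    rw [AddSubgroup.relIndex_sup_left, ← AddSubgroup.inf_relIndex_right]
    exact card_mul_relIndex_of_le inf_le_right
  have hidx_dvd : R.relIndex (R ⊔ B) ∣ R.relIndex D :=
    Dvd.intro _ (AddSubgroup.relIndex_mul_relIndex R (R ⊔ B) D le_sup_left (sup_le hRD hBD))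
  have hRDcard : Nat.card R * R.relIndex D = Nat.card D := card_mul_relIndex_of_le hRD
  -- positivity of `#𝓛_w`
  haveI := finite_galoisCohomology_one_torsion_inl W p w
  have hℓpos : 0 < ℓw := Nat.card_pos
  have hRBle : Nat.card RB ∣ Nat.card R₀ := AddSubgroup.card_dvd_of_le hBR
  -- assemble: `#B · #Str ∣ #𝓛_w · t`
  have key : Nat.card B * Nat.card Str ∣ ℓw * (R.relIndex D * Nat.card Str) := by
    rw [← hBeq]
    calc Nat.card RB * R.relIndex (R ⊔ B) * Nat.card Str
        ∣ ℓw * R.relIndex D * Nat.card Str :=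
          Nat.mul_dvd_mul (Nat.mul_dvd_mul (hRBle.trans hR₀dvd) hidx_dvd) dvd_rfl
      _ = ℓw * (R.relIndex D * Nat.card Str) := by ring
  have ht : R.relIndex D * Nat.card Str = t := by
    have h := hRDcard
    rw [hcardD, ← hcardR] at h
    -- `#Str · ℓw · [D:R] = ℓw · t`
    have h' : ℓw * (R.relIndex D * Nat.card Str) = ℓw * t := by
      calc ℓw * (R.relIndex D * Nat.card Str) = Nat.card Str * ℓw * R.relIndex D := by ring
        _ = ℓw * t := h
    exact Nat.eq_of_mul_eq_mul_left hℓpos h'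
  rw [ht] at key
  rw [hBdef, natCard_selmerGroup_transport_kummer W Y p φ ψ hψφ hφψ 𝓐 h𝓐] at key
  exact key

end StrictLaw


/-! ## §2 Over `ℚ`: the identity door on the STRICT cell gives a `2`-Selmer-minimal twin -/

section Rat

open Summit.BirchSwinnertonDyer.BirchSwinnertonDyer.Theorems.GenusKolyTwistLocal
open Summit.BirchSwinnertonDyer.BirchSwinnertonDyer.Theorems.SchneiderFreeAdditiveX3.PoitouTateReduction
  (poitouTate_selmerStructure_duality_real_holds)
open Rat.HeightOneSpectrum (primesEquiv)

variable (W : WeierstrassCurve ℚ) [W.IsElliptic] [W.IsGloballyMinimal] {K : Type} [Field K] [NumberField K]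

/-- **THE IDENTITY DOOR ON THE STRICT CELL: `#Sel₂(W^{(−ℓ)}) = 2` — UNCONDITIONAL.**  `W/ℚ` globally minimal elliptic, `Δ_W > 0`, `#Sel₂(W) = 4` with EVERY class
trivial at `∞` (the STRICT cell of the residual item 31767: rank `0`, `Ш(W)[2] ≅ (ℤ/2)²` real-trivial); `K = ℚ(√−ℓ)` with `d_K = −ℓ` odd, Heegner for `N_W`, `2` split; `ℓ`
an IDENTITY prime (`#W(ℚ_ℓ)[2] = 4`) at which `Sel₂(W)` has no non-zero class in `strictLocalKer_ℓ` (its two generators restrict to a basis of `W(ℚ_ℓ)/2`).  Then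
every model `Wd` of `W^{(d_K)}` has **`#Sel₂(Wd) = 2`**: §1 with `#𝓛_∞ = 2`, `t_ℓ = 4` gives `#Sel₂(Wd) · 4 ∣ 8`, and Kramer's framed congruence (`S = {∞, ℓ}`, both
transversal, `[𝓚_∞ : 0]·[𝓚_ℓ : 0] = 8`) makes `#Sel₂(Wd) · 4 · 8` a square.  This is the COUNT half of LINE 24 «strict_def2»'s stub A⁼² (defect-`2` minimal twin on the
strict cell); its Čebotarev half is `exists_identityPrime_pair_not_mem_strictLocalKer` applied to a basis of `Sel₂(W)`.
[cite: MazurRubin2010, Lemmas 2.9–2.11, Lemma 3.2, Prop. 3.3] [cite: Kramer1981, Prop. 6, Thm. 1] -/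
theorem natCard_selmerGroup_twin_eq_two_of_identityDoor_strict (hΔ : 0 < W.Δ) (hSel : Nat.card (W.selmerGroup 2) = 4)
    (hK : IsImaginaryQuadratic K) (hodd : Odd (discr K)) (hH : SatisfiesHeegnerHypothesis (W.conductorNorm ℤ) K)
    (h2K : ((Ideal.span {(2 : ℤ)}).primesOver (𝓞 K)).ncard = 2)
    {ℓ : ℕ} [Fact ℓ.Prime] (hd : discr K = -(ℓ : ℤ))
    (hid : Nat.card {Q : (W.baseChange ℚ_[ℓ]).toAffine.Point // 2 • Q = 0} = 4)
    (hstr : ∀ c ∈ (W.kummerSelmerStructure ((2 : ℕ) : ℤ)).selmerGroup,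
      galoisCohomology.localization (W.torsionGaloisModule ((2 : ℕ) : ℤ)) (Sum.inl Rat.infinitePlace) 1 c = 0)
    (hinj : ∀ c ∈ (W.kummerSelmerStructure ((2 : ℕ) : ℤ)).selmerGroup, c ∈ MazurRubin2010.strictLocalKer W ℚ_[ℓ] 2 → c = 0)
    (Wd : WeierstrassCurve ℚ) [Wd.IsElliptic] (hWd : ∃ C : VariableChange ℚ, C • W.quadraticTwist (discr K : ℚ) = Wd) :
    Nat.card (Wd.selmerGroup 2) = 2 := by
  haveI : Fact (Nat.Prime 2) := ⟨Nat.prime_two⟩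
  have hℓ : ℓ.Prime := Fact.out
  obtain ⟨hℓ2, hℓN, -⟩ := GenusKolyTwin.prime_discr_facts W hK hodd hH hℓ hd
  have hPT := poitouTate_selmerStructure_duality_real_holds (K := ℚ)
  have hEP := GenusKolyLowering.localEP ℚ
  obtain ⟨v₀, hv₀⟩ : ∃ v : HeightOneSpectrum (𝓞 ℚ), ((primesEquiv v : Nat.Primes) : ℕ) = ℓ :=
    ⟨primesEquiv.symm ⟨ℓ, hℓ⟩, by rw [Equiv.apply_symm_apply]⟩
  have hℓv₀ : (ℓ : 𝓞 ℚ) ∈ v₀.asIdeal := by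
    rw [← hv₀]
    exact Rat.HeightOneSpectrum.natCast_natGenerator_mem v₀
  obtain ⟨C, hC⟩ := hWd
  have hdneg : (discr K : ℚ) < 0 := by
    rw [hd]; push_cast
    exact neg_neg_of_pos (by exact_mod_cast hℓ.pos)
  have hd0 : (discr K : ℚ) ≠ 0 := hdneg.ne
  have hW : W.HasGoodReductionAt v₀ := by
    by_contra h
    exact hℓN (hv₀ ▸ (W.dvd_conductorNorm_iff v₀).mpr h)
  have h2v₀ : ((2 : ℕ) : 𝓞 ℚ) ∉ v₀.asIdeal :=
    GenusKolyTwistingPrime.natCast_not_mem_of_not_dvd hℓ hℓv₀ fun h ↦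
      hℓ2 ((Nat.prime_dvd_prime_iff_eq hℓ Nat.prime_two).mp h)
  have h12 : (Sum.inl Rat.infinitePlace : Place ℚ) ≠ Sum.inr v₀ := Sum.inl_ne_inr
  obtain ⟨φ, ψ, hψφ, hφψ, hsplit, -, htr, hrtr, π, A, hπ, hA⟩ := exists_intertwining_master_frame W Wd hd0 hC
  let 𝓐 : SelmerStructure (W.torsionGaloisModule ((2 : ℕ) : ℤ)) := fun v ↦
    (Wd.kummerSelmerStructure ((2 : ℕ) : ℤ) v).map (galoisCohomology.map (φ.restrictField (Place.Completion v)) 1)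
  have h𝓐 : ∀ v, 𝓐 v = (Wd.kummerSelmerStructure ((2 : ℕ) : ℤ) v).map
      (galoisCohomology.map (φ.restrictField (Place.Completion v)) 1) := fun _ ↦ rfl
  have hfin := twist_place_menu_finite_rat W hK.1 hH h2K hℓ hd hℓv₀ hC
  have hagree : ∀ v : Place ℚ, v ≠ Sum.inl Rat.infinitePlace → v ≠ Sum.inr v₀ →
      𝓐 v = W.kummerSelmerStructure ((2 : ℕ) : ℤ) v := by
    rintro (w | v) hw hv
    · exact absurd (by rw [Subsingleton.elim w Rat.infinitePlace]) hw
    · have hvv₀ : v ≠ v₀ := fun h ↦ hv (by rw [h])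
      rcases hfin v hvv₀ with ⟨s, hs⟩ | ⟨h2v, hvW, hvWd⟩ | ⟨h2v, h1W, h1Wd⟩
      · rw [h𝓐, kummerSelmerStructure_apply, kummerSelmerStructure_apply]
        exact hsplit (Place.Completion (Sum.inr v)) ⟨s, hs⟩
      · exact transport_kummer_inr_eq_of_good W Wd 2 φ ψ hφψ 𝓐 h𝓐 h2v hvW hvWd
      · rw [h𝓐, kummerSelmerStructure_apply, kummerSelmerStructure_apply]
        exact map_kummerLocalConditionAt_adicCompletion_eq_of_natCard_ker_eq_one W Wd v two_ne_zero h2v h1W h1Wd φ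
  have hagreeS : ∀ v ∉ ({(Sum.inl Rat.infinitePlace : Place ℚ), Sum.inr v₀} : Finset (Place ℚ)),
      𝓐 v = W.kummerSelmerStructure ((2 : ℕ) : ℤ) v := fun v hv ↦
    hagree v (fun h ↦ hv (by simp [h])) (fun h ↦ hv (by simp [h]))
  have hram : closureEmb (K := ℚ) (v₀.adicCompletion ℚ) (geomSqrt (discr K : ℚ)) ∉ maxUnramified (v₀.adicCompletion ℚ) := by
    apply GenusKolyTwistRamified.closureEmb_geomSqrt_not_mem_maxUnramified_rat v₀
    rw [hd]; push_cast
    exact GenusKolyTwistRamified.valuation_neg_natCast_eq_exp_neg_one_of_mem v₀ hℓ hℓv₀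
  have htr₀ : 𝓐 (Sum.inr v₀) ⊓ W.kummerSelmerStructure ((2 : ℕ) : ℤ) (Sum.inr v₀) = ⊥ := by
    rw [h𝓐, kummerSelmerStructure_apply, kummerSelmerStructure_apply]
    exact htr v₀ hW h2v₀ hram
  have hKv₀ : Nat.card (W.kummerSelmerStructure ((2 : ℕ) : ℤ) (Sum.inr v₀)) = 4 := by
    rw [W.natCard_kummerSelmerStructure_inr v₀ two_ne_zero, natCard_ker_nsmul_adicCompletion_eq_padic W v₀ 2,
      natCard_quotient_span_natCast_eq_one_of_not_mem v₀ h2v₀, mul_one]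
    subst hv₀
    exact hid
  have ht : Nat.card (nsmulAddMonoidHom 2 : (W.baseChange (v₀.adicCompletion ℚ)).toAffine.Point →+ _).ker *
      Nat.card (v₀.adicCompletionIntegers ℚ ⧸ Ideal.span {((2 : ℕ) : v₀.adicCompletionIntegers ℚ)}) = 4 := by
    rw [← W.natCard_kummerSelmerStructure_inr v₀ two_ne_zero]
    exact hKv₀
  have hKinf : Nat.card (W.kummerSelmerStructure ((2 : ℕ) : ℤ) (Sum.inl Rat.infinitePlace)) = 2 :=
    natCard_kummerSelmerStructure_inl_rat_eq_two_of_Δ_pos W hΔ _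
  -- `Sel₂(W)` is strict at `∞`: it IS `H¹_{𝓚_{∞}}`
  have hStr : (kummerStrict W 2 {(Sum.inl Rat.infinitePlace : Place ℚ)}).selmerGroup =
      (W.kummerSelmerStructure ((2 : ℕ) : ℤ)).selmerGroup := by
    refine le_antisymm (selmerGroup_sandwich_kummer W 2 _).1 fun c hc ↦ ?_
    rw [SelmerStructure.mem_selmerGroup_iff]
    intro v
    by_cases hv : v ∈ ({(Sum.inl Rat.infinitePlace : Place ℚ)} : Finset (Place ℚ))
    · rw [kummerStrict_of_mem W 2 _ hv, Finset.mem_singleton.mp hv, hstr c hc]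
      exact zero_mem _
    · rw [kummerStrict_of_not_mem W 2 _ hv]
      exact (SelmerStructure.mem_selmerGroup_iff _ _).mp hc v
  -- injectivity on the strict group, in the abstract currency
  have hinj' : ∀ c ∈ (kummerStrict W 2 {(Sum.inl Rat.infinitePlace : Place ℚ)}).selmerGroup,
      galoisCohomology.localization (W.torsionGaloisModule ((2 : ℕ) : ℤ)) (Sum.inr v₀) 1 c = 0 → c = 0 := by
    intro c hc h0
    rw [hStr] at hc
    refine hinj c hc ?_
    have h1 : c ∈ W.torsionLocalKer (v₀.adicCompletion ℚ) ((2 : ℕ) : ℤ) :=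
      (mem_torsionLocalKer_iff_localization_eq_zero_rat W v₀ c).mpr h0
    haveI := Fact.mk (primesEquiv v₀).2
    letI : Algebra ℚ (v₀.adicCompletion ℚ) := inferInstance
    haveI : CharZero (v₀.adicCompletion ℚ) :=
      Literature.NumberTheory.GaloisRepresentations.charZero_adicCompletion v₀
    have h2 := (GenusKolyTwistingPrime.mem_torsionLocalKer_padic_iff W
      (RingEquivClass.toRingEquiv (Rat.HeightOneSpectrum.adicCompletion.padicEquiv (R := 𝓞 ℚ) v₀)) ((2 : ℕ) : ℤ) c).mpr h1
    subst hv₀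
    exact h2
  -- the count: `#Sel₂(Wd) · 4 ∣ 2 · 4`
  have hdvd := natCard_selmerGroup_mul_natCard_dvd_of_transverse_of_injective_strict W Wd 2 hPT hEP φ ψ hψφ hφψ 𝓐 h𝓐
    Rat.isReal_infinitePlace v₀ hagree htr₀ hinj'
  rw [ht, hKinf, hStr, ← selmerGroup_eq_selmerGroup_kummerSelmerStructure] at hdvd
  change Nat.card (Wd.selmerGroup 2) * Nat.card (W.selmerGroup 2) ∣ 2 * 4 at hdvd
  rw [hSel] at hdvd
  have h2 : Nat.card (Wd.selmerGroup 2) ∣ 2 := Nat.dvd_of_mul_dvd_mul_right (by norm_num : 0 < 4) hdvd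
  -- Kramer's framed congruence: `#Sel₂(Wd) · 4 · 8` is a square
  have hsq := GenusKolyKramer.isSquare_card_selmerGroup_mul_of_frame W Wd φ (Function.LeftInverse.injective hψφ) π hπ A hA
    𝓐 h𝓐 {(Sum.inl Rat.infinitePlace : Place ℚ), Sum.inr v₀} hagreeS
  have hrel_inf : (𝓐 (Sum.inl Rat.infinitePlace)).relIndex (W.kummerSelmerStructure ((2 : ℕ) : ℤ) (Sum.inl Rat.infinitePlace)) = 2 := by
    have htr_inf : 𝓐 (Sum.inl Rat.infinitePlace) ⊓ W.kummerSelmerStructure ((2 : ℕ) : ℤ) (Sum.inl Rat.infinitePlace) = ⊥ := by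
      rw [h𝓐, kummerSelmerStructure_apply, kummerSelmerStructure_apply]
      exact hrtr Rat.infinitePlace Rat.isReal_infinitePlace
        (by rw [embedding_of_isReal_rat_apply]; exact_mod_cast hΔ) (forall_sq_ne_completion_of_neg hdneg _)
    rw [← AddSubgroup.inf_relIndex_right, htr_inf, AddSubgroup.relIndex_bot_left]
    exact hKinf
  have hrel_v₀ : (𝓐 (Sum.inr v₀)).relIndex (W.kummerSelmerStructure ((2 : ℕ) : ℤ) (Sum.inr v₀)) = 4 := by
    rw [← AddSubgroup.inf_relIndex_right, htr₀, AddSubgroup.relIndex_bot_left]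
    exact hKv₀
  rw [Finset.prod_pair h12, hrel_inf, hrel_v₀] at hsq
  change IsSquare (Nat.card (Wd.selmerGroup 2) * Nat.card (W.selmerGroup 2) * (2 * 4)) at hsq
  rw [hSel] at hsq
  rcases (Nat.dvd_prime Nat.prime_two).mp h2 with h1 | h2'
  · exfalso
    rw [h1] at hsq
    have h32 : IsSquare (2 ^ 5) := by simpa using hsq
    exact absurd ((isSquare_two_pow_iff_even 5).mp h32) (by decide)
  · exact h2'

end Rat

end Summit.BirchSwinnertonDyer.BirchSwinnertonDyer.Theorems.GenusExact.TwinSwap.IdentityDoor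

end
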